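import Summits.NavierStokesRegularity.FunctionalMining.TopEigStrainMixHeat
import Summits.NavierStokesRegularity.FunctionalMining.SaturatingLawSup
import HarnessLib

/-!
# FunctionalMining/NoGo — door D-K6 (c) typed to ONE obligation: Theorem G (ii) for the symmetrised
# core `Φ_q + Ψ_q = ∫(λ₁⁺)^q(S) + ∫((−λ₃)⁺)^q(S)` and for every top–bottom mixture `αΦ_q + βΨ_q`

Search for candidate a priori estimates; no regularity claim. Cell `pub-nsfunc`, no-go seat (gen 36),
STAGED for the prove seat (the planner seat cannot file under `FunctionalMining/`; see
`pub-nsfunc-nogo/NoGo/STAGING.md`). Imports ONLY tree files, used BY NAME: the prove seat's (gen 17)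
L-λ template `TopEig.hasDerivWithinAt_le_of_heatCoercive_admissible` (`TopEigSaturatingSup`) and
`SaturatingLawSup`; census-2's power-mean toolbox `TopEig.qMean` (`qMean_nonneg/_rpow/_add_le/_mono/_mul`,
`TopEigMixDensity`) and `TopEig.heatDissipation_const_mul` (`TopEigStrainMixHeat`); the dict seat's
candidate nodes `topBotEigMoment`, `TopBotEigMomentLaw`, `TopBotEigHeatCoercivePos` (`SpectralMixtureCandidates`).

CONTEXT. Door D-K6 of `NOGO.md` §3 (the `λ₁`-moment rows `ES.lam1.q | T_LD` die at `ε = 0`,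
`NoGo/TopEigSaturatingKill`) has three typed escapes: (a) the strain mixtures `Φ_q + εZ_q` (law PROVED
for `ε > 0`; rate window K1/K3/K4 + MRO), (b) the low moments `3/2 < q < 2` (open), and **(c) the
symmetrised core `Φ_q + Ψ_q`**: `TopBotEigMomentLaw q` OPEN, and "`TopBotEigHeatCoercivePos q` — the
coercive step that the proof template of Theorem G (ii) WOULD need for (c). OPEN" (dict seat). Nothing
in the tree connected the two nodes: the template wants `Φ = ∫ g(S)^q` for ONE admissible density `g`
(convex, `1`-Lipschitz, `0 ≤ g(S) ≤ |S| ≤ 6 g(S)` on divergence-free strains), and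
`(λ₁⁺)^q + ((−λ₃)⁺)^q` is not `g^q` for a convex `g` — as written.

MECHANISM. After normalisation it is: `(λ₁⁺)^q + ((−λ₃)⁺)^q = 2 · M_q(λ₁⁺, (−λ₃)⁺)^q` with the POWER
MEAN `M_q(x, y) = ((x^q + y^q)/2)^{1/q}`, and `A ↦ M_q(λ⁺(A), λ⁺(−A))` IS admissible: the `ℓ^q`-mean of
two non-negative convex `1`-Lipschitz functions is convex and `1`-Lipschitz (monotonicity of the mean +
two-term Minkowski), and `|S|/6 ≤ min(λ₁, −λ₃) ≤ M_q ≤ max(λ₁, −λ₃) ≤ |S|` on divergence-free strains by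
the tree's coercivity of BOTH one-sided cores (`norm_strainFlat_le`, `norm_strainFlat_le_lam_neg`). More
generally `G_{a,b}(A) = M(aλ⁺(A), bλ⁺(−A))`, `a^q + b^q = 1`, represents every normalised mixture
`αΦ_q + βΨ_q` (`α = a^q`, `β = b^q`) — census-2's `mixDensity` (escape (a); second slot `b‖A‖`) with the
second slot replaced by `bλ⁺(−A)`; the §1 proofs are census-2's slot for slot (acknowledged). Heat
coercivity passes through positive scalings (`heatDissipation_const_mul`), so `HeatCoercive (Φ_q + Ψ_q) c`
gives `HeatCoercive (½Φ_q + ½Ψ_q) c`, the template applies, and the factor `2` is absorbed into `κ`.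

CONTENT (`T³ = UnitAddTorus (Fin 3)`; `σ = 2q − 3`, `γ = (3q−3)/(2q−3)` the K0 `T_LD` exponents):
* §1 `TopEig.topBotDensity q a b` — convex, `1`-Lipschitz, `|S|/6 ≤ G(S) ≤ |S|`,
  `∫ G(S)^q = a^q Φ_q + b^q Ψ_q` (`integral_topBotDensity_rpow`);
* §2 **`TopEig.topBotMix_saturatingLawSup`**: real `q ≥ 2`, `α, β ≥ 0`, `α + β = 1`, `c > 0` ⇒
  `HeatCoercive (αΦ_q + βΨ_q) c → ∃ κ ≥ 0, SaturatingLawSup (αΦ_q + βΨ_q) σ γ κ` (Theorem G (ii) for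
  every normalised top–bottom mixture; `α = 1` / `β = 1` are the tree rows of `SaturatingLawSup.lean`);
* §3 **`TopEig.topBotEigMomentLaw_of_heatCoercivePos : 2 ≤ q → TopBotEigHeatCoercivePos q →
  TopBotEigMomentLaw q`** — door (c) reduced to ONE obligation in the kernel, for every real `q ≥ 2`, at
  the K0 exponents (rows `q = 2, 3, 4`: `(σ, γ) = (1, 3), (3, 2), (5, 9/5)`); and the kill-side
  contrapositive `TopEig.not_topBotEigHeatCoercivePos_of_forall_not_law`: a kernel kill of (c) in the
  conclusion shape of the door's family theorems (`∀ κ, ¬ SaturatingLawSup …`) refutes the symmetrised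
  L-λ lemma.

NOT claimed: neither node of (c) is decided — both stay OPEN (`@[conjecture]`, dict seat); on paper the
no-go census records that the W18 family kills `Φ_q + Ψ_q` from NEITHER sign and that no mollified
two-well wall does (NOGO.md §3 D-K6 (W-5); paper, not kernel); nothing for `q < 2`; the
differentiability clause of the `IsRateBudget` form is not supplied (as for the one-sided rows); and
nothing about Navier–Stokes regularity or blow-up — every statement is an implication between candidate
a priori inequalities along short-time classical solutions from smooth data. [ours]
FILING (prove seat g26, REQUEST #19): declarations byte-identical to the no-go seat's staged `TopBotEigSaturatingSup.STAGING.lean` 9632f815703261cb; this line is the only addition.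
-/

noncomputable section

open MeasureTheory Set Filter Topology Finset
open scoped InnerProductSpace RealInnerProductSpace ContDiff

namespace Summit.NavierStokesRegularity.FunctionalMining

open Literature.Analysis.FunctionSpaces Literature.Analysis.FunctionSpaces.Torus
  Literature.Analysis.FluidPDE

namespace TopEig

open StrainL4 StrainMoment

/-! ## 1. The admissible top–bottom density `G(A) = ((a λ⁺(A))^q + (b λ⁺(−A))^q)^{1/q}` on `ℝ^{3×3}` -/

/-- The top–bottom mixture density `G_{q,a,b}(A) = ((a λ⁺(A))^q + (b λ⁺(−A))^q)^{1/q}`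
(`λ⁺(A) = max (lam A) 0`; on a divergence-free strain `λ⁺(S) = λ₁`, `λ⁺(−S) = −λ₃`). [ours] -/
def topBotDensity (q a b : ℝ) (A : EuclideanSpace ℝ (Fin 3 × Fin 3)) : ℝ :=
  qMean q (a * max (lam A) 0) (b * max (lam (-A)) 0)

/-- `G(A) ≥ 0` for `a, b ≥ 0`. [ours, bookkeeping] -/
theorem topBotDensity_nonneg (q : ℝ) {a b : ℝ} (ha : 0 ≤ a) (hb : 0 ≤ b)
    (A : EuclideanSpace ℝ (Fin 3 × Fin 3)) : 0 ≤ topBotDensity q a b A :=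
  qMean_nonneg q (mul_nonneg ha (le_max_right _ _)) (mul_nonneg hb (le_max_right _ _))

/-- `G^q = a^q (λ⁺(A))^q + b^q (λ⁺(−A))^q`. [ours] -/
theorem topBotDensity_rpow {q : ℝ} (hq : 0 < q) {a b : ℝ} (ha : 0 ≤ a) (hb : 0 ≤ b)
    (A : EuclideanSpace ℝ (Fin 3 × Fin 3)) :
    topBotDensity q a b A ^ q = a ^ q * max (lam A) 0 ^ q + b ^ q * max (lam (-A)) 0 ^ q := by
  unfold topBotDensity
  rw [qMean_rpow hq (mul_nonneg ha (le_max_right _ _)) (mul_nonneg hb (le_max_right _ _)),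
    Real.mul_rpow ha (le_max_right _ _), Real.mul_rpow hb (le_max_right _ _)]

/-- `c · max (λ(sA + tB)) 0 ≤ s (c λ⁺(A)) + t (c λ⁺(B))` (`λ` convex, `c ≥ 0`). [ours, bookkeeping] -/
theorem mul_posPart_lam_convex_le {c : ℝ} (hc : 0 ≤ c) {A B : EuclideanSpace ℝ (Fin 3 × Fin 3)}
    {s t : ℝ} (hs : 0 ≤ s) (ht : 0 ≤ t) (hst : s + t = 1) :
    c * max (lam (s • A + t • B)) 0 ≤ s * (c * max (lam A) 0) + t * (c * max (lam B) 0) := by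
  have hl : lam (s • A + t • B) ≤ s * lam A + t * lam B := by
    have h := convexOn_lam.2 (mem_univ A) (mem_univ B) hs ht hst
    simpa only [smul_eq_mul] using h
  have hm : max (lam (s • A + t • B)) 0 ≤ s * max (lam A) 0 + t * max (lam B) 0 := by
    refine max_le ?_
      (add_nonneg (mul_nonneg hs (le_max_right _ _)) (mul_nonneg ht (le_max_right _ _)))
    exact hl.trans (add_le_add (mul_le_mul_of_nonneg_left (le_max_left _ _) hs)
      (mul_le_mul_of_nonneg_left (le_max_left _ _) ht))
  calc c * max (lam (s • A + t • B)) 0 ≤ c * (s * max (lam A) 0 + t * max (lam B) 0) :=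
        mul_le_mul_of_nonneg_left hm hc
    _ = s * (c * max (lam A) 0) + t * (c * max (lam B) 0) := by ring

/-- **`G` is convex** (`q ≥ 1`, `a, b ≥ 0`): the `ℓ^q`-mean of two non-negative convex functions
(monotonicity of the mean, two-term Minkowski, positive homogeneity). [ours] -/
theorem convexOn_topBotDensity {q : ℝ} (hq : 1 ≤ q) {a b : ℝ} (ha : 0 ≤ a) (hb : 0 ≤ b) :
    ConvexOn ℝ univ (topBotDensity q a b) := by
  have hq0 : 0 < q := by linarith
  refine ⟨convex_univ, fun A _ B _ s t hs ht hst => ?_⟩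
  have h1A : 0 ≤ a * max (lam A) 0 := mul_nonneg ha (le_max_right _ _)
  have h1B : 0 ≤ a * max (lam B) 0 := mul_nonneg ha (le_max_right _ _)
  have h2A : 0 ≤ b * max (lam (-A)) 0 := mul_nonneg hb (le_max_right _ _)
  have h2B : 0 ≤ b * max (lam (-B)) 0 := mul_nonneg hb (le_max_right _ _)
  have hf1 : a * max (lam (s • A + t • B)) 0 ≤ s * (a * max (lam A) 0) + t * (a * max (lam B) 0) :=
    mul_posPart_lam_convex_le ha hs ht hst
  have hf2 : b * max (lam (-(s • A + t • B))) 0 ≤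
      s * (b * max (lam (-A)) 0) + t * (b * max (lam (-B)) 0) := by
    have e : -(s • A + t • B) = s • (-A) + t • (-B) := by rw [smul_neg, smul_neg, neg_add]
    rw [e]
    exact mul_posPart_lam_convex_le hb hs ht hst
  calc topBotDensity q a b (s • A + t • B)
      ≤ qMean q (s * (a * max (lam A) 0) + t * (a * max (lam B) 0))
          (s * (b * max (lam (-A)) 0) + t * (b * max (lam (-B)) 0)) :=
        qMean_mono hq0 (mul_nonneg ha (le_max_right _ _)) hf1 (mul_nonneg hb (le_max_right _ _)) hf2
    _ ≤ qMean q (s * (a * max (lam A) 0)) (s * (b * max (lam (-A)) 0)) +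
          qMean q (t * (a * max (lam B) 0)) (t * (b * max (lam (-B)) 0)) :=
        qMean_add_le hq (mul_nonneg hs h1A) (mul_nonneg hs h2A) (mul_nonneg ht h1B)
          (mul_nonneg ht h2B)
    _ = s • topBotDensity q a b A + t • topBotDensity q a b B := by
        rw [qMean_mul hq0 hs h1A h2A, qMean_mul hq0 ht h1B h2B, smul_eq_mul, smul_eq_mul]
        rfl

/-- `c λ⁺(A) ≤ c λ⁺(B) + c‖A − B‖` for `c ≥ 0` (`λ` is `1`-Lipschitz). [ours, bookkeeping] -/
theorem mul_posPart_lam_le_add {c : ℝ} (hc : 0 ≤ c) (A B : EuclideanSpace ℝ (Fin 3 × Fin 3)) :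
    c * max (lam A) 0 ≤ c * max (lam B) 0 + c * ‖A - B‖ := by
  have hlam : lam A ≤ lam B + ‖A - B‖ := by
    have h := lipschitzWith_lam.dist_le_mul A B
    rw [NNReal.coe_one, one_mul, Real.dist_eq, dist_eq_norm] at h
    linarith [le_abs_self (lam A - lam B)]
  have h : max (lam A) 0 ≤ max (lam B) 0 + ‖A - B‖ :=
    max_le (hlam.trans (add_le_add (le_max_left _ _) le_rfl))
      (add_nonneg (le_max_right _ _) (norm_nonneg _))
  calc c * max (lam A) 0 ≤ c * (max (lam B) 0 + ‖A - B‖) := mul_le_mul_of_nonneg_left h hc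
    _ = c * max (lam B) 0 + c * ‖A - B‖ := by ring

/-- **`G` is `1`-Lipschitz** when `a^q + b^q = 1` (`q ≥ 1`, `a, b ≥ 0`). [ours] -/
theorem lipschitzWith_topBotDensity {q : ℝ} (hq : 1 ≤ q) {a b : ℝ} (ha : 0 ≤ a) (hb : 0 ≤ b)
    (hab : a ^ q + b ^ q = 1) : LipschitzWith 1 (topBotDensity q a b) := by
  have hq0 : 0 < q := by linarith
  have hN1 : qMean q a b = 1 := by unfold qMean; rw [hab, Real.one_rpow]
  refine LipschitzWith.of_le_add fun A B => ?_
  rw [dist_eq_norm]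
  have hf1 : a * max (lam A) 0 ≤ a * max (lam B) 0 + a * ‖A - B‖ := mul_posPart_lam_le_add ha A B
  have hf2 : b * max (lam (-A)) 0 ≤ b * max (lam (-B)) 0 + b * ‖A - B‖ := by
    have h := mul_posPart_lam_le_add hb (-A) (-B)
    rwa [show (-A : EuclideanSpace ℝ (Fin 3 × Fin 3)) - -B = -(A - B) by abel, norm_neg] at h
  calc topBotDensity q a b A
      ≤ qMean q (a * max (lam B) 0 + a * ‖A - B‖) (b * max (lam (-B)) 0 + b * ‖A - B‖) :=
        qMean_mono hq0 (mul_nonneg ha (le_max_right _ _)) hf1 (mul_nonneg hb (le_max_right _ _)) hf2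
    _ ≤ qMean q (a * max (lam B) 0) (b * max (lam (-B)) 0) + qMean q (a * ‖A - B‖) (b * ‖A - B‖) :=
        qMean_add_le hq (mul_nonneg ha (le_max_right _ _)) (mul_nonneg hb (le_max_right _ _))
          (mul_nonneg ha (norm_nonneg _)) (mul_nonneg hb (norm_nonneg _))
    _ = topBotDensity q a b B + ‖A - B‖ := by
        rw [mul_comm a ‖A - B‖, mul_comm b ‖A - B‖, qMean_mul hq0 (norm_nonneg _) ha hb, hN1,
          mul_one]
        rfl

/-- `G(A) ≤ |A|` when `a^q + b^q = 1` (`λ⁺(A) ≤ |A|`, `λ⁺(−A) ≤ |A|`). [ours] -/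
theorem topBotDensity_le_norm {q : ℝ} (hq : 0 < q) {a b : ℝ} (ha : 0 ≤ a) (hb : 0 ≤ b)
    (hab : a ^ q + b ^ q = 1) (A : EuclideanSpace ℝ (Fin 3 × Fin 3)) :
    topBotDensity q a b A ≤ ‖A‖ := by
  have hm : max (lam A) 0 ≤ ‖A‖ := max_le (lam_le_norm A) (norm_nonneg _)
  have hm' : max (lam (-A)) 0 ≤ ‖A‖ :=
    max_le ((lam_le_norm (-A)).trans (norm_neg A).le) (norm_nonneg _)
  have hN1 : qMean q a b = 1 := by unfold qMean; rw [hab, Real.one_rpow]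
  calc topBotDensity q a b A ≤ qMean q (a * ‖A‖) (b * ‖A‖) :=
        qMean_mono hq (mul_nonneg ha (le_max_right _ _)) (mul_le_mul_of_nonneg_left hm ha)
          (mul_nonneg hb (le_max_right _ _)) (mul_le_mul_of_nonneg_left hm' hb)
    _ = ‖A‖ := by
        rw [mul_comm a, mul_comm b, qMean_mul hq (norm_nonneg _) ha hb, hN1, mul_one]

/-- `|A| ≤ 6 G(A)` when `a^q + b^q = 1`, `|A| ≤ 6λ(A)` and `|A| ≤ 6λ(−A)` (the divergence-free strain
case: BOTH one-sided cores are coercive). [ours] -/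
theorem norm_le_six_mul_topBotDensity {q : ℝ} (hq : 0 < q) {a b : ℝ} (ha : 0 ≤ a) (hb : 0 ≤ b)
    (hab : a ^ q + b ^ q = 1) {A : EuclideanSpace ℝ (Fin 3 × Fin 3)} (hA : ‖A‖ ≤ 6 * lam A)
    (hA' : ‖A‖ ≤ 6 * lam (-A)) : ‖A‖ ≤ 6 * topBotDensity q a b A := by
  have hN1 : qMean q a b = 1 := by unfold qMean; rw [hab, Real.one_rpow]
  have h6 : 0 ≤ ‖A‖ / 6 := by positivity
  have h1 : a * (‖A‖ / 6) ≤ a * max (lam A) 0 :=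
    mul_le_mul_of_nonneg_left ((by linarith : ‖A‖ / 6 ≤ lam A).trans (le_max_left _ _)) ha
  have h2 : b * (‖A‖ / 6) ≤ b * max (lam (-A)) 0 :=
    mul_le_mul_of_nonneg_left ((by linarith : ‖A‖ / 6 ≤ lam (-A)).trans (le_max_left _ _)) hb
  have h := qMean_mono hq (mul_nonneg ha h6) h1 (mul_nonneg hb h6) h2
  rw [mul_comm a (‖A‖ / 6), mul_comm b (‖A‖ / 6), qMean_mul hq h6 ha hb, hN1, mul_one] at h
  have h' : ‖A‖ / 6 ≤ topBotDensity q a b A := h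
  linarith

/-- **`∫ G(S)^q = a^q Φ_q + b^q Ψ_q`** on smooth divergence-free fields of `T³`
(`Φ_q = ∫(λ₁⁺)^q`, `Ψ_q = ∫((−λ₃)⁺)^q`). [ours] -/
theorem integral_topBotDensity_rpow {q : ℝ} (hq : 0 < q) {a b : ℝ} (ha : 0 ≤ a) (hb : 0 ≤ b)
    {v : UnitAddTorus (Fin 3) → EuclideanSpace ℝ (Fin 3)} (hv : Torus.IsSmooth v)
    (hdiv : Torus.IsDivFree v) :
    ∫ x, topBotDensity q a b (strainFlat v x) ^ q =
      a ^ q * torusTopEigMoment q v + b ^ q * torusNegBotEigMoment q v := by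
  have hpt : ∀ x, topBotDensity q a b (strainFlat v x) ^ q =
      a ^ q * lam (strainFlat v x) ^ q + b ^ q * lam (-strainFlat v x) ^ q := by
    intro x
    rw [topBotDensity_rpow hq ha hb, max_eq_left (lam_strainFlat_nonneg hv hdiv x),
      max_eq_left (lam_neg_strainFlat_nonneg hv hdiv x)]
  simp_rw [hpt]
  have hc1 : Continuous fun x => lam (strainFlat v x) ^ q :=
    (lipschitzWith_lam.continuous.comp (continuous_strainFlat hv)).rpow_const fun _ => Or.inr hq.le
  have hc2 : Continuous fun x => lam (-strainFlat v x) ^ q :=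
    (lipschitzWith_lam.continuous.comp (continuous_strainFlat hv).neg).rpow_const
      fun _ => Or.inr hq.le
  rw [integral_add (hc1.integrable_unitAddTorus.const_mul _) (hc2.integrable_unitAddTorus.const_mul _),
    integral_const_mul, integral_const_mul, torusTopEigMoment_eq hv hdiv q,
    torusNegBotEigMoment_eq hv hdiv q]

/-! ## 2. Theorem G (ii) for every normalised top–bottom mixture `αΦ_q + βΨ_q` -/

/-- **Lemma L-λ ⇒ the `T_LD` law for `αΦ_q + βΨ_q`, derivative-value form** (real `q ≥ 2`, `α, β ≥ 0`,
`α + β = 1`, `c > 0`): `HeatCoercive (αΦ_q + βΨ_q) c` gives `κ ≥ 0` such that along every zero-mean classical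
solution of unforced Navier–Stokes (`ν > 0`) on `T³ × [a, b]` every one-sided derivative value `R` of
`s ↦ αΦ_q(u s) + βΨ_q(u s)` within the window obeys `R ≤ κ ν^{−γ} (2ℰ) (αΦ_q + βΨ_q)^{1+1/σ}`. [ours] -/
theorem topBotMix_rate_le_of_heatCoercive {q : ℝ} (hq : 2 ≤ q) {α β : ℝ} (hα : 0 ≤ α) (hβ : 0 ≤ β)
    (hαβ : α + β = 1) {c : ℝ} (hc : 0 < c)
    (hL : HeatCoercive (d := Fin 3)
      (fun w => α * torusTopEigMoment q w + β * torusNegBotEigMoment q w) c) :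
    ∃ κ : ℝ, 0 ≤ κ ∧ ∀ {ν a b : ℝ}, 0 < ν → a < b →
      ∀ {u : ℝ → UnitAddTorus (Fin 3) → EuclideanSpace ℝ (Fin 3)} {p : ℝ → UnitAddTorus (Fin 3) → ℝ},
      Torus.IsClassicalNSSolutionOn (Icc a b) ν 0 u p → (∀ t ∈ Icc a b, Torus.HasZeroMean (u t)) →
      ∀ t ∈ Icc a b, ∀ R : ℝ,
        HasDerivWithinAt (fun s => α * torusTopEigMoment q (u s) + β * torusNegBotEigMoment q (u s)) R
          (Icc a b) t →
        R ≤ κ * ν ^ (-((3 * q - 3) / (2 * q - 3))) *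
          ((2 * torusEnstrophy (u t)) *
            (α * torusTopEigMoment q (u t) + β * torusNegBotEigMoment q (u t)) ^ (1 + (2 * q - 3)⁻¹)) := by
  have hq0 : 0 < q := by linarith
  have hq1 : 1 ≤ q := by linarith
  have ha : 0 ≤ α ^ (1 / q) := Real.rpow_nonneg hα _
  have hb : 0 ≤ β ^ (1 / q) := Real.rpow_nonneg hβ _
  have haq : (α ^ (1 / q)) ^ q = α := by rw [one_div, Real.rpow_inv_rpow hα hq0.ne']
  have hbq : (β ^ (1 / q)) ^ q = β := by rw [one_div, Real.rpow_inv_rpow hβ hq0.ne']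
  have hab : (α ^ (1 / q)) ^ q + (β ^ (1 / q)) ^ q = 1 := by rw [haq, hbq, hαβ]
  exact hasDerivWithinAt_le_of_heatCoercive_admissible hq
    (convexOn_topBotDensity hq1 ha hb) (lipschitzWith_topBotDensity hq1 ha hb hab)
    (fun w _ _ x => topBotDensity_nonneg q ha hb _)
    (fun w hw hdw x => norm_le_six_mul_topBotDensity hq0 ha hb hab (norm_strainFlat_le hw hdw x)
      (norm_strainFlat_le_lam_neg hw hdw x))
    (fun w _ _ x => topBotDensity_le_norm hq0 ha hb hab _)
    (Φ := fun w => α * torusTopEigMoment q w + β * torusNegBotEigMoment q w)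
    (fun w hw hdw => by
      show α * torusTopEigMoment q w + β * torusNegBotEigMoment q w = _
      rw [integral_topBotDensity_rpow hq0 ha hb hw hdw, haq, hbq])
    hc hL

/-- **Theorem G (ii) for the normalised top–bottom mixtures** (real `q ≥ 2`, `α, β ≥ 0`, `α + β = 1`,
`c > 0`): `HeatCoercive (αΦ_q + βΨ_q) c → ∃ κ ≥ 0, SaturatingLawSup (αΦ_q + βΨ_q) (2q−3) ((3q−3)/(2q−3)) κ`
(`α = 1` / `β = 1`: the tree rows `topEigMoment_/negBotEigMoment_saturatingLawSup_of_heatCoercivePos`). -/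
theorem topBotMix_saturatingLawSup {q : ℝ} (hq : 2 ≤ q) {α β : ℝ} (hα : 0 ≤ α) (hβ : 0 ≤ β)
    (hαβ : α + β = 1) {c : ℝ} (hc : 0 < c)
    (hL : HeatCoercive (d := Fin 3)
      (fun w => α * torusTopEigMoment q w + β * torusNegBotEigMoment q w) c) :
    ∃ κ : ℝ, 0 ≤ κ ∧ SaturatingLawSup (d := Fin 3)
      (fun w => α * torusTopEigMoment q w + β * torusNegBotEigMoment q w)
      (2 * q - 3) ((3 * q - 3) / (2 * q - 3)) κ := by
  obtain ⟨κ, hκ0, hκ⟩ := topBotMix_rate_le_of_heatCoercive hq hα hβ hαβ hc hL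
  refine ⟨κ, hκ0, ?_⟩
  intro _ ν hν t₁ t₂ h12 u p hsol hmean t ht R hR
  calc R ≤ κ * ν ^ (-((3 * q - 3) / (2 * q - 3))) * ((2 * torusEnstrophy (u t)) *
        (α * torusTopEigMoment q (u t) + β * torusNegBotEigMoment q (u t)) ^ (1 + (2 * q - 3)⁻¹)) :=
        hκ hν h12 hsol hmean t ht R hR
    _ = κ * ν ^ (-((3 * q - 3) / (2 * q - 3))) * (2 * torusEnstrophy (u t)) *
        (α * torusTopEigMoment q (u t) + β * torusNegBotEigMoment q (u t)) ^ (1 + (2 * q - 3)⁻¹) := by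
        ring

/-! ## 3. Door D-K6 (c): the symmetrised core `Φ_q + Ψ_q` -/

/-- Heat coercivity passes through non-negative scalings of the functional. [ours, bookkeeping] -/
theorem heatCoercive_const_mul {d : Type*} [Fintype d] [DecidableEq d]
    {F : (UnitAddTorus d → EuclideanSpace ℝ d) → ℝ} {c k : ℝ} (h : HeatCoercive (d := d) F c)
    (hk : 0 ≤ k) : HeatCoercive (d := d) (fun w => k * F w) c := by
  intro hd v hv hdiv hmean
  rw [heatDissipation_const_mul F hk v]
  calc c * (k * F v) = k * (c * F v) := by ring
    _ ≤ k * heatDissipation F v := mul_le_mul_of_nonneg_left (h hd v hv hdiv hmean) hk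

/-- `½Φ_q + ½Ψ_q = ½ (Φ_q + Ψ_q)`. [ours, bookkeeping] -/
theorem half_topBotMix_eq (q : ℝ) :
    (fun w : UnitAddTorus (Fin 3) → EuclideanSpace ℝ (Fin 3) =>
        (1 / 2 : ℝ) * torusTopEigMoment q w + (1 / 2 : ℝ) * torusNegBotEigMoment q w) =
      fun w => (1 / 2 : ℝ) * topBotEigMoment q w := by
  funext w
  simp only [topBotEigMoment]
  ring

/-- **Lemma L-λ ⇒ the `T_LD` law for `Φ_q + Ψ_q`** (real `q ≥ 2`): `HeatCoercive (Φ_q + Ψ_q) c` with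
`c > 0` gives `κ ≥ 0` with `SaturatingLawSup (Φ_q + Ψ_q) (2q−3) ((3q−3)/(2q−3)) κ` — via the law for
`½Φ_q + ½Ψ_q = ½(Φ_q + Ψ_q)`, heat-coercive at the same rate; the factor `2` goes into `κ`. [ours] -/
theorem topBotEigMoment_saturatingLawSup_of_heatCoercive {q : ℝ} (hq : 2 ≤ q) {c : ℝ} (hc : 0 < c)
    (hL : HeatCoercive (d := Fin 3) (topBotEigMoment q) c) :
    ∃ κ : ℝ, 0 ≤ κ ∧
      SaturatingLawSup (d := Fin 3) (topBotEigMoment q) (2 * q - 3) ((3 * q - 3) / (2 * q - 3)) κ := by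
  have hL' : HeatCoercive (d := Fin 3)
      (fun w => (1 / 2 : ℝ) * torusTopEigMoment q w + (1 / 2 : ℝ) * torusNegBotEigMoment q w) c := by
    rw [half_topBotMix_eq q]
    exact heatCoercive_const_mul hL (by norm_num)
  obtain ⟨κ, hκ0, hκ⟩ := topBotMix_saturatingLawSup hq (α := 1 / 2) (β := 1 / 2)
    (by norm_num) (by norm_num) (by norm_num) hc hL'
  set e : ℝ := 1 + (2 * q - 3)⁻¹ with he
  refine ⟨2 * κ * (1 / 2 : ℝ) ^ e, by positivity, ?_⟩
  intro h3 ν hν a b hab u p hsol hmean t ht R hR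
  have hR' : HasDerivWithinAt
      (fun s => (1 / 2 : ℝ) * torusTopEigMoment q (u s) + (1 / 2 : ℝ) * torusNegBotEigMoment q (u s))
      ((1 / 2 : ℝ) * R) (Icc a b) t := by
    have h := hR.const_mul (1 / 2 : ℝ)
    rwa [show (fun s => (1 / 2 : ℝ) * topBotEigMoment q (u s)) = fun s =>
        (1 / 2 : ℝ) * torusTopEigMoment q (u s) + (1 / 2 : ℝ) * torusNegBotEigMoment q (u s) from
      funext fun s => (congrFun (half_topBotMix_eq q) (u s)).symm] at h
  have h := hκ h3 hν hab hsol hmean t ht _ hR'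
  have hhalf : (1 / 2 : ℝ) * torusTopEigMoment q (u t) + (1 / 2 : ℝ) * torusNegBotEigMoment q (u t) =
      (1 / 2 : ℝ) * topBotEigMoment q (u t) := congrFun (half_topBotMix_eq q) (u t)
  beta_reduce at h
  rw [hhalf, Real.mul_rpow (by norm_num : (0 : ℝ) ≤ 1 / 2) (topBotEigMoment_nonneg q (u t))] at h
  calc R = 2 * ((1 / 2 : ℝ) * R) := by ring
    _ ≤ 2 * (κ * ν ^ (-((3 * q - 3) / (2 * q - 3))) * (2 * torusEnstrophy (u t)) *
          ((1 / 2 : ℝ) ^ e * topBotEigMoment q (u t) ^ e)) :=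
        mul_le_mul_of_nonneg_left h (by norm_num)
    _ = 2 * κ * (1 / 2 : ℝ) ^ e * ν ^ (-((3 * q - 3) / (2 * q - 3))) * (2 * torusEnstrophy (u t)) *
          topBotEigMoment q (u t) ^ e := by ring

/-- **Theorem G (ii) for the symmetrised core (kernel): `TopBotEigHeatCoercivePos q → ∃ κ ≥ 0,
SaturatingLawSup (Φ_q + Ψ_q) (2q−3) ((3q−3)/(2q−3)) κ`** for every real `q ≥ 2`. [ours] -/
theorem topBotEigMoment_saturatingLawSup_of_heatCoercivePos {q : ℝ} (hq : 2 ≤ q)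
    (hL : TopBotEigHeatCoercivePos (d := Fin 3) q) :
    ∃ κ : ℝ, 0 ≤ κ ∧
      SaturatingLawSup (d := Fin 3) (topBotEigMoment q) (2 * q - 3) ((3 * q - 3) / (2 * q - 3)) κ := by
  obtain ⟨c, hc, hLc⟩ := hL
  exact topBotEigMoment_saturatingLawSup_of_heatCoercive hq hc hLc

/-- **Door D-K6 (c) in the kernel: `TopBotEigHeatCoercivePos q → TopBotEigMomentLaw q`** for every real
`q ≥ 2` — the candidate law of the symmetrised core `Φ_q + Ψ_q` follows from its heat coercivity alone
(the dict seat's two `@[conjecture]` nodes of escape (c), `SpectralMixtureCandidates`; neither is decided). -/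
theorem topBotEigMomentLaw_of_heatCoercivePos {q : ℝ} (hq : 2 ≤ q)
    (hL : TopBotEigHeatCoercivePos (d := Fin 3) q) : TopBotEigMomentLaw (d := Fin 3) q := by
  obtain ⟨κ, hκ0, h⟩ := topBotEigMoment_saturatingLawSup_of_heatCoercivePos hq hL
  exact ⟨κ, hκ0, h⟩

/-- The law for all larger constants. [ours, bookkeeping] -/
theorem topBotEigMoment_saturatingLawSup_eventually {q : ℝ} (hq : 2 ≤ q)
    (hL : TopBotEigHeatCoercivePos (d := Fin 3) q) :
    ∃ κ₀ : ℝ, ∀ κ, κ₀ ≤ κ →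
      SaturatingLawSup (d := Fin 3) (topBotEigMoment q) (2 * q - 3) ((3 * q - 3) / (2 * q - 3)) κ := by
  obtain ⟨κ₀, _, h⟩ := topBotEigMoment_saturatingLawSup_of_heatCoercivePos hq hL
  exact ⟨κ₀, fun κ hκ => h.mono_kappa (topBotEigMoment_nonneg q) hκ⟩

/-- **The kill side of door (c):** a kernel kill of the symmetrised core's law in the conclusion shape of
the door's family theorems (`∀ κ, ¬ SaturatingLawSup (Φ_q + Ψ_q) …`, cf. `NoGo/TopEigSaturatingKill` for
`Φ_q` alone) refutes the symmetrised L-λ lemma (real `q ≥ 2`). Nothing is killed here. [ours] -/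
theorem not_topBotEigHeatCoercivePos_of_forall_not_law {q : ℝ} (hq : 2 ≤ q)
    (hkill : ∀ κ : ℝ,
      ¬ SaturatingLawSup (d := Fin 3) (topBotEigMoment q) (2 * q - 3) ((3 * q - 3) / (2 * q - 3)) κ) :
    ¬ TopBotEigHeatCoercivePos (d := Fin 3) q := fun hL => by
  obtain ⟨κ, _, h⟩ := topBotEigMoment_saturatingLawSup_of_heatCoercivePos hq hL
  exact hkill κ h

/-- **The rows `q = 2, 3, 4` of door (c)** (K0 exponents `(σ, γ) = (1, 3), (3, 2), (5, 9/5)`), each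
conditional on the symmetrised L-λ lemma only. [ours] -/
theorem topBotEigMoment_saturatingLawSup_rows :
    (TopBotEigHeatCoercivePos (d := Fin 3) 2 →
      ∃ κ : ℝ, 0 ≤ κ ∧ SaturatingLawSup (d := Fin 3) (topBotEigMoment 2) 1 3 κ) ∧
    (TopBotEigHeatCoercivePos (d := Fin 3) 3 →
      ∃ κ : ℝ, 0 ≤ κ ∧ SaturatingLawSup (d := Fin 3) (topBotEigMoment 3) 3 2 κ) ∧
    (TopBotEigHeatCoercivePos (d := Fin 3) 4 →
      ∃ κ : ℝ, 0 ≤ κ ∧ SaturatingLawSup (d := Fin 3) (topBotEigMoment 4) 5 (9 / 5) κ) := by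
  refine ⟨fun h => ?_, fun h => ?_, fun h => ?_⟩
  · have h2 := topBotEigMoment_saturatingLawSup_of_heatCoercivePos (q := 2) (by norm_num) h
    norm_num at h2; exact h2
  · have h3 := topBotEigMoment_saturatingLawSup_of_heatCoercivePos (q := 3) (by norm_num) h
    norm_num at h3; exact h3
  · have h4 := topBotEigMoment_saturatingLawSup_of_heatCoercivePos (q := 4) (by norm_num) h
    norm_num at h4; exact h4

end TopEig

end Summit.NavierStokesRegularity.FunctionalMining

end
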